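import Mathlib
import HarnessLib
import Summits.NavierStokesRegularity.NavierStokesRegularity.Theorems.TypeILiouvilleStrainLedgerOsgoodFloor
import Summits.NavierStokesRegularity.NavierStokesRegularity.Theorems.TypeILiouvilleStrainLedgerAligned

/-!
# TypeILiouvilleStrainLedgerOsgoodAligned — crux (L) stmt-NavierStokesRegularity-10661 `TypeIliouvilleL`,
# residual L_Q / Type-I door: THE ALIGNED OSGOOD FLOOR AND THE LOG-SCALE EXCHANGE RATE OF THE TWO DIALS

Helper for stmt-NavierStokesRegularity-10661 (`--supports`); theorems only, no definitions, no named-fact hypotheses;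
closes no item; Navier–Stokes regularity is NOT proved here (leafhand seat of the EulerZoomLiouville route).
Sequel of `TypeILiouvilleStrainLedgerOsgoodFloor` (Osgood form of the unit stretching threshold) and
`TypeILiouvilleStrainLedgerAligned` (only stretching ALONG THE VORTICITY is charged).

Class P = print's class of bounded ancient mild solutions; `ω = curl v`; aligned stretching rate
`σ(τ,x) = ⟪∇v(τ,x) ω, ω⟫/|ω|²` (Constantin's depletion quantity).

* §1 `const_of_pastAlignedLedger_tendsto_zero` — eventual ALIGNED ledger Liouville (`Ω(s)·exp ∫_s^T Λ → 0` with `Λ`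
  majorising `σ` only); `const_of_typeIVorticity_of_divergent_alignedDeficit` — **ALIGNED OSGOOD FLOOR AT THE TYPE-I
  VORTICITY RATE**: `‖ω‖ ≤ M/(−τ)` (any `M`) and `σ ≤ a(τ)/(−τ)` on a far past with divergent deficit
  `∫_s^T (1 − a)/(−τ) → +∞` ⟹ one constant vector; `const_of_alignedStretching_le_one_sub_div_log` — the log cell
  `(−τ)·σ ≤ 1 − c/log(−τ)`; `exists_alignedStretching_gt_of_nonconst` — a NON-CONSTANT class-P flow with Type-I-rate
  vorticity on a far past carries, below every `T` and for every `c > 0`, a point where the vorticity is non-zero and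
  the ALIGNED stretching number exceeds `1 − c/log(−τ)`.
* §2 `const_of_logDials` / `const_of_logDials_aligned` — **LOG-SCALE EXCHANGE RATE AT THE TYPE-I THRESHOLD**: vorticity
  `‖ω(τ,x)‖ ≤ M/((−τ)(log(−τ))^p)` and stretching (form, resp. aligned) `≤ (1 + q/log(−τ))/(−τ)` on a far past with
  `q < p` ⟹ constant: one logarithm of vorticity decay below the Type-I rate buys one logarithm of stretching EXCESS
  above the unit threshold (ledger `∝ (log(−s))^{q−p} → 0`).  `p = 0, q = −c` is the Osgood log cell; `q = 0, p > 0`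
  says: vorticity `O(1/((−t) logᵖ(−t)))` with ANY constant plus unit stretching ⟹ constant (compare the hypothesis-free
  `o(1/((−t) log(−t)))` of `TypeILiouvilleLambTail.const_of_vorticity_littleO_log`).

HONEST LABEL: Grönwall bookkeeping on the tree's (aligned) vorticity-stretching comparison; the scale-invariant corner
`p = q = 0` (Type-I Liouville) is untouched; nothing here proves a registered stub, (L), or NS regularity; rung 0.
[cite: MajdaBertozziCUP2002, eq. (3.80)] [cite: Constantin1994, §2] [cite: KochNadirashviliSereginSverak2009, §4 (i) (arXiv:0709.3599)]
-/

noncomputable section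
open MeasureTheory Filter Set Function Metric
open scoped Topology RealInnerProductSpace ENNReal NNReal
open Literature.Analysis Literature.Analysis.FluidPDE Literature.Analysis.UnboundedOperators
set_option linter.dupNamespace false
namespace Summit.NavierStokesRegularity.NavierStokesRegularity.Theorems.TypeILiouvilleStrainLedger

/-! ## §1 The aligned Osgood floor -/

/-- **EVENTUAL ALIGNED LEDGER LIOUVILLE.**  As `const_of_pastLedger_tendsto_zero`, with the strain majorant read only
along the vorticity: `⟪∇v(τ,x) ω, ω⟫ ≤ Λ τ ‖ω‖²` for `τ < T`, `‖ω(τ,x)‖ ≤ Ω τ` for `τ < T`, and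
`Ω(s) · exp ∫_s^T Λ → 0` as `s → −∞` ⟹ one constant vector (time shift + `const_of_alignedStarved` + forward
rigidity). [cite: MajdaBertozziCUP2002, eq. (3.80)] [cite: Constantin1994, §2] -/
theorem const_of_pastAlignedLedger_tendsto_zero
    {v : ℝ → EuclideanSpace ℝ (Fin 3) → EuclideanSpace ℝ (Fin 3)}
    (hc : ContinuousOn (uncurry v) (Iio 0 ×ˢ univ))
    (hK : ∃ K : ℝ, ∀ t < 0, ∀ x, ‖v t x‖ ≤ K)
    (hd : ∀ t < 0, IsWeaklyDivFree (v t))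
    (hm : ∀ s t : ℝ, s < t → t < 0 → ∀ x,
      v t x = heatExtension (v s) (t - s) x - oseenDuhamel 1 s v v t x)
    {T : ℝ} (hT : T < 0) {Λ Ω : ℝ → ℝ} (hΛc : Continuous Λ)
    (hΛ : ∀ τ < T, ∀ x : EuclideanSpace ℝ (Fin 3),
      ⟪fderiv ℝ (v τ) x (curl (v τ) x), curl (v τ) x⟫ ≤ Λ τ * ‖curl (v τ) x‖ ^ 2)
    (hΩ : ∀ τ < T, ∀ x : EuclideanSpace ℝ (Fin 3), ‖curl (v τ) x‖ ≤ Ω τ)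
    (hlim : Tendsto (fun s : ℝ => Ω s * Real.exp (∫ τ in s..T, Λ τ)) atBot (𝓝 0)) :
    ∃ b : EuclideanSpace ℝ (Fin 3), ∀ t < 0, ∀ x, v t x = b := by
  obtain ⟨hc', hK', hd', hm'⟩ := classP_timeShift hc hK hd hm hT.le
  have hstarved : ∀ t < 0, ∀ ε : ℝ, 0 < ε → ∃ s : ℝ, s < t ∧ ∃ Λ' : ℝ → ℝ, Continuous Λ' ∧
      (∀ τ ∈ Icc s t, ∀ x : EuclideanSpace ℝ (Fin 3),
        ⟪fderiv ℝ (v (τ + T)) x (curl (v (τ + T)) x), curl (v (τ + T)) x⟫ ≤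
          Λ' τ * ‖curl (v (τ + T)) x‖ ^ 2) ∧
      ∃ Ω₀ : ℝ, (∀ x, ‖curl (v (s + T)) x‖ ≤ Ω₀) ∧ Ω₀ * Real.exp (∫ τ in s..t, Λ' τ) < ε := by
    intro t ht ε hε
    obtain ⟨c, hc_def⟩ : ∃ c : ℝ, c = Real.exp (-(∫ τ in (t + T)..T, Λ τ)) := ⟨_, rfl⟩
    have hc0 : 0 < c := by rw [hc_def]; exact Real.exp_pos _
    have hεc : 0 < ε / c := div_pos hε hc0
    obtain ⟨σ₀, hσ₀⟩ := (hlim.eventually (gt_mem_nhds hεc)).exists_forall_of_atBot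
    set σ : ℝ := min σ₀ (t + T - 1) with hσ
    have hσle : σ ≤ σ₀ := min_le_left _ _
    have hσt : σ < t + T := by have := min_le_right σ₀ (t + T - 1); linarith
    have hσT : σ < T := by linarith
    refine ⟨σ - T, by linarith, fun τ => Λ (τ + T), hΛc.comp (continuous_id.add continuous_const),
      fun τ hτ x => hΛ (τ + T) (by linarith [hτ.2]) x, Ω σ, fun x => ?_, ?_⟩
    · have h := hΩ σ hσT x
      simpa only [sub_add_cancel] using h
    · have hshift : ∫ τ in (σ - T)..t, Λ (τ + T) = ∫ τ in σ..(t + T), Λ τ := by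
        rw [intervalIntegral.integral_comp_add_right]
        simp only [sub_add_cancel]
      have hsplit : ∫ τ in σ..(t + T), Λ τ = (∫ τ in σ..T, Λ τ) - ∫ τ in (t + T)..T, Λ τ := by
        rw [eq_sub_iff_add_eq]
        exact intervalIntegral.integral_add_adjacent_intervals (hΛc.intervalIntegrable _ _)
          (hΛc.intervalIntegrable _ _)
      have hkey : Ω σ * Real.exp (∫ τ in (σ - T)..t, Λ (τ + T)) =
          Ω σ * Real.exp (∫ τ in σ..T, Λ τ) * c := by
        rw [hshift, hsplit, hc_def, sub_eq_add_neg, Real.exp_add]; ring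
      have h1 : Ω σ * Real.exp (∫ τ in σ..T, Λ τ) < ε / c := hσ₀ σ hσle
      calc Ω σ * Real.exp (∫ τ in (σ - T)..t, Λ (τ + T))
          = Ω σ * Real.exp (∫ τ in σ..T, Λ τ) * c := hkey
        _ < ε / c * c := mul_lt_mul_of_pos_right h1 hc0
        _ = ε := div_mul_cancel₀ ε hc0.ne'
  obtain ⟨b, hb⟩ := const_of_alignedStarved (v := fun t x => v (t + T) x) hc' hK' hd' hm' hstarved
  refine ⟨b, classP_const_of_const_below hc hK hm (T := T) fun τ hτ x => ?_⟩
  have h := hb (τ - T) (by linarith) x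
  simp only [sub_add_cancel] at h
  exact h

/-- **ALIGNED OSGOOD FLOOR AT THE TYPE-I VORTICITY RATE.**  A class-P flow with, on a far past `τ < T < 0`, vorticity
`‖ω(τ,x)‖ ≤ M/(−τ)` (any `M`) and ALIGNED stretching `⟪∇v(τ,x) ω, ω⟫ ≤ (a(τ)/(−τ))‖ω‖²` (`a` continuous, any sign),
whose deficit integral diverges, `∫_s^T (1 − a(τ)) dτ/(−τ) → +∞` (`s → −∞`), is one constant vector (ledger
`M e^{−D(s)}/(−T) → 0`, §1).  Vorticity sitting in compressive/neutral strain directions is not charged.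
[cite: MajdaBertozziCUP2002, eq. (3.80)] [cite: Constantin1994, §2] -/
theorem const_of_typeIVorticity_of_divergent_alignedDeficit
    {v : ℝ → EuclideanSpace ℝ (Fin 3) → EuclideanSpace ℝ (Fin 3)}
    (hc : ContinuousOn (uncurry v) (Iio 0 ×ˢ univ))
    (hK : ∃ K : ℝ, ∀ t < 0, ∀ x, ‖v t x‖ ≤ K)
    (hd : ∀ t < 0, IsWeaklyDivFree (v t))
    (hm : ∀ s t : ℝ, s < t → t < 0 → ∀ x,
      v t x = heatExtension (v s) (t - s) x - oseenDuhamel 1 s v v t x)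
    {T : ℝ} (hT : T < 0) {a : ℝ → ℝ} (hac : Continuous a) {M : ℝ}
    (hstr : ∀ τ < T, ∀ x : EuclideanSpace ℝ (Fin 3),
      ⟪fderiv ℝ (v τ) x (curl (v τ) x), curl (v τ) x⟫ ≤ a τ / (-τ) * ‖curl (v τ) x‖ ^ 2)
    (hω : ∀ τ < T, ∀ x : EuclideanSpace ℝ (Fin 3), ‖curl (v τ) x‖ ≤ M / (-τ))
    (hdiv : Tendsto (fun s : ℝ => ∫ τ in s..T, (1 - a τ) / (-τ)) atBot atTop) :
    ∃ b : EuclideanSpace ℝ (Fin 3), ∀ t < 0, ∀ x, v t x = b := by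
  have hT0 : 0 < -T := neg_pos.2 hT
  set Λ : ℝ → ℝ := fun τ => a τ / max (-τ) (-T) with hΛ
  have hden : ∀ τ : ℝ, max (-τ) (-T) ≠ 0 := fun τ => (lt_of_lt_of_le hT0 (le_max_right _ _)).ne'
  have hΛc : Continuous Λ := hac.div (continuous_neg.max continuous_const) hden
  have hΛeq : ∀ τ, τ ≤ T → Λ τ = a τ / (-τ) := fun τ hτ => by
    simp only [hΛ, max_eq_left (neg_le_neg hτ)]
  refine const_of_pastAlignedLedger_tendsto_zero hc hK hd hm hT hΛc (Ω := fun τ => M / (-τ))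
    (fun τ hτ x => by rw [hΛeq τ hτ.le]; exact hstr τ hτ x) hω ?_
  have hclosed : ∀ s < T, M / (-s) * Real.exp (∫ τ in s..T, Λ τ) =
      M / (-T) * Real.exp (-(∫ τ in s..T, (1 - a τ) / (-τ))) := by
    intro s hs
    have hs0 : 0 < -s := by linarith
    have hcongr : ∫ τ in s..T, Λ τ = ∫ τ in s..T, (1 / (-τ) - (1 - a τ) / (-τ)) := by
      refine intervalIntegral.integral_congr fun τ hτ => ?_
      rw [uIcc_of_le hs.le] at hτ
      rw [hΛeq τ hτ.2, div_sub_div_same]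
      ring
    have hcont2 : ContinuousOn (fun τ : ℝ => (1 - a τ) / (-τ)) (uIcc s T) := by
      refine (continuousOn_const.sub hac.continuousOn).div continuousOn_id.neg fun τ hτ => ?_
      rw [uIcc_of_le hs.le] at hτ
      exact (neg_pos.2 (lt_of_le_of_lt hτ.2 hT)).ne'
    have hcont1 : ContinuousOn (fun τ : ℝ => 1 / (-τ)) (uIcc s T) := by
      refine continuousOn_const.div continuousOn_id.neg fun τ hτ => ?_
      rw [uIcc_of_le hs.le] at hτ
      exact (neg_pos.2 (lt_of_le_of_lt hτ.2 hT)).ne'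
    have hs1 : s ≠ 0 := by linarith
    have hT1 : T ≠ 0 := hT.ne
    rw [hcongr, intervalIntegral.integral_sub hcont1.intervalIntegrable hcont2.intervalIntegrable,
      integral_one_div_neg_eq_log hs hT, sub_eq_add_neg, Real.exp_add, Real.exp_sub, Real.exp_log hs0,
      Real.exp_log hT0]
    field_simp
  have hexp : Tendsto (fun s : ℝ => M / (-T) * Real.exp (-(∫ τ in s..T, (1 - a τ) / (-τ)))) atBot (𝓝 0) := by
    have h := (Real.tendsto_exp_atBot.comp (tendsto_neg_atTop_atBot.comp hdiv)).const_mul (M / (-T))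
    rw [mul_zero] at h
    exact h
  refine hexp.congr' ?_
  filter_upwards [eventually_lt_atBot T] with s hs
  exact (hclosed s hs).symm

/-- **THE ALIGNED LOG CELL.**  Vorticity `‖ω(τ,x)‖ ≤ M/(−τ)` and ALIGNED stretching
`⟪∇v(τ,x) ω, ω⟫ ≤ ((1 − c/log(−τ))/(−τ))‖ω‖²` for all `τ < T < −1` (`c > 0`) force constancy (deficit integral
`c (log log(−s) − log log(−T)) → +∞`). [cite: MajdaBertozziCUP2002, eq. (3.80)] [cite: Constantin1994, §2] -/
theorem const_of_alignedStretching_le_one_sub_div_log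
    {v : ℝ → EuclideanSpace ℝ (Fin 3) → EuclideanSpace ℝ (Fin 3)}
    (hc : ContinuousOn (uncurry v) (Iio 0 ×ˢ univ))
    (hK : ∃ K : ℝ, ∀ t < 0, ∀ x, ‖v t x‖ ≤ K)
    (hd : ∀ t < 0, IsWeaklyDivFree (v t))
    (hm : ∀ s t : ℝ, s < t → t < 0 → ∀ x,
      v t x = heatExtension (v s) (t - s) x - oseenDuhamel 1 s v v t x)
    {T c M : ℝ} (hT : T < -1) (hc0 : 0 < c)
    (hstr : ∀ τ < T, ∀ x : EuclideanSpace ℝ (Fin 3),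
      ⟪fderiv ℝ (v τ) x (curl (v τ) x), curl (v τ) x⟫ ≤
        (1 - c / Real.log (-τ)) / (-τ) * ‖curl (v τ) x‖ ^ 2)
    (hω : ∀ τ < T, ∀ x : EuclideanSpace ℝ (Fin 3), ‖curl (v τ) x‖ ≤ M / (-τ)) :
    ∃ b : EuclideanSpace ℝ (Fin 3), ∀ t < 0, ∀ x, v t x = b := by
  have hT0 : T < 0 := by linarith
  have hT1 : 1 < -T := by linarith
  set a : ℝ → ℝ := fun τ => 1 - c / Real.log (max (-τ) (-T)) with ha
  have hmax1 : ∀ τ : ℝ, 1 < max (-τ) (-T) := fun τ => lt_of_lt_of_le hT1 (le_max_right _ _)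
  have hlogpos : ∀ τ : ℝ, 0 < Real.log (max (-τ) (-T)) := fun τ => Real.log_pos (hmax1 τ)
  have hac : Continuous a := by
    refine continuous_const.sub (continuous_const.div ?_ fun τ => (hlogpos τ).ne')
    exact (continuous_neg.max continuous_const).log fun τ => (lt_trans zero_lt_one (hmax1 τ)).ne'
  have haeq : ∀ τ, τ ≤ T → a τ = 1 - c / Real.log (-τ) := fun τ hτ => by
    simp only [ha, max_eq_left (neg_le_neg hτ)]
  refine const_of_typeIVorticity_of_divergent_alignedDeficit hc hK hd hm hT0 hac (M := M)
    (fun τ hτ x => by rw [haeq τ hτ.le]; exact hstr τ hτ x) hω ?_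
  have hclosed : ∀ s < T, ∫ τ in s..T, (1 - a τ) / (-τ) =
      c * (Real.log (Real.log (-s)) - Real.log (Real.log (-T))) := by
    intro s hs
    rw [← integral_div_neg_mul_log_eq hs hT]
    refine intervalIntegral.integral_congr fun τ hτ => ?_
    rw [uIcc_of_le hs.le] at hτ
    rw [haeq τ hτ.2, sub_sub_cancel, div_div, mul_comm]
  have hlim : Tendsto (fun s : ℝ => c * (Real.log (Real.log (-s)) - Real.log (Real.log (-T)))) atBot atTop := by
    refine Tendsto.const_mul_atTop hc0 (tendsto_atTop_add_const_right _ _ ?_)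
    exact Real.tendsto_log_atTop.comp (Real.tendsto_log_atTop.comp tendsto_neg_atBot_atTop)
  refine hlim.congr' ?_
  filter_upwards [eventually_lt_atBot T] with s hs
  exact (hclosed s hs).symm

/-- **REFINED ALIGNED FLOOR OF A NON-CONSTANT FLOW WITH TYPE-I-RATE VORTICITY.**  If a NON-CONSTANT class-P flow has
`‖ω(τ,x)‖ ≤ M/(−τ)` for all `τ < T₀`, then for every `T ≤ T₀` with `T < −1` and every `c > 0` there are `τ < T` and
`x` with `⟪∇v(τ,x) ω, ω⟫ > ((1 − c/log(−τ))/(−τ))‖ω‖²` — in particular `ω(τ,x) ≠ 0` there when `c ≤ log(−τ)`, and the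
ALIGNED stretching number `(−τ)·σ(τ,x)` exceeds `1 − c/log(−τ)`. [cite: Constantin1994, §2] [cite: MajdaBertozziCUP2002, eq. (3.80)] -/
theorem exists_alignedStretching_gt_of_nonconst
    {v : ℝ → EuclideanSpace ℝ (Fin 3) → EuclideanSpace ℝ (Fin 3)}
    (hc : ContinuousOn (uncurry v) (Iio 0 ×ˢ univ))
    (hK : ∃ K : ℝ, ∀ t < 0, ∀ x, ‖v t x‖ ≤ K)
    (hd : ∀ t < 0, IsWeaklyDivFree (v t))
    (hm : ∀ s t : ℝ, s < t → t < 0 → ∀ x,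
      v t x = heatExtension (v s) (t - s) x - oseenDuhamel 1 s v v t x)
    (hne : ¬ ∃ b : EuclideanSpace ℝ (Fin 3), ∀ t < 0, ∀ x, v t x = b)
    {T₀ M : ℝ} (hω : ∀ τ < T₀, ∀ x : EuclideanSpace ℝ (Fin 3), ‖curl (v τ) x‖ ≤ M / (-τ))
    {T c : ℝ} (hTT₀ : T ≤ T₀) (hT : T < -1) (hc0 : 0 < c) :
    ∃ τ : ℝ, τ < T ∧ ∃ x : EuclideanSpace ℝ (Fin 3),
      (1 - c / Real.log (-τ)) / (-τ) * ‖curl (v τ) x‖ ^ 2 <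
        ⟪fderiv ℝ (v τ) x (curl (v τ) x), curl (v τ) x⟫ := by
  by_contra hcon
  push Not at hcon
  exact hne (const_of_alignedStretching_le_one_sub_div_log hc hK hd hm hT hc0 (M := M)
    (fun τ hτ x => hcon τ hτ x) (fun τ hτ x => hω τ (lt_of_lt_of_le hτ hTT₀) x))

/-! ## §2 The log-scale exchange rate of the two dials at the Type-I threshold -/

/-- `exp(q (log A − log B)) = A^q / B^q` for `A, B > 0`. [folklore] -/
theorem exp_mul_log_sub_log {A B q : ℝ} (hA : 0 < A) (hB : 0 < B) :
    Real.exp (q * (Real.log A - Real.log B)) = A ^ q / B ^ q := by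
  rw [Real.rpow_def_of_pos hA, Real.rpow_def_of_pos hB, ← Real.exp_sub]
  congr 1; ring

/-- `∫_s^T (1 + q/log(−τ)) dτ/(−τ) = (log(−s) − log(−T)) + q (log log(−s) − log log(−T))` for `s < T < −1`. [folklore] -/
theorem integral_one_add_div_log_div_neg_eq {s T q : ℝ} (hsT : s < T) (hT : T < -1) :
    ∫ τ in s..T, (1 + q / Real.log (-τ)) / (-τ) =
      (Real.log (-s) - Real.log (-T)) + q * (Real.log (Real.log (-s)) - Real.log (Real.log (-T))) := by
  have hT0 : T < 0 := by linarith
  have hpos : ∀ τ ∈ uIcc s T, 1 < -τ := by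
    intro τ hτ
    rw [uIcc_of_le hsT.le] at hτ
    linarith [hτ.2]
  have hcongr : ∫ τ in s..T, (1 + q / Real.log (-τ)) / (-τ) =
      ∫ τ in s..T, (1 / (-τ) + q / ((-τ) * Real.log (-τ))) := by
    refine intervalIntegral.integral_congr fun τ hτ => ?_
    rw [add_div, div_div, mul_comm (Real.log (-τ))]
  have hcont1 : ContinuousOn (fun τ : ℝ => 1 / (-τ)) (uIcc s T) := by
    refine continuousOn_const.div continuousOn_id.neg fun τ hτ => ?_
    have h1 := hpos τ hτ
    exact (lt_trans zero_lt_one h1).ne'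
  have hcont2 : ContinuousOn (fun τ : ℝ => q / ((-τ) * Real.log (-τ))) (uIcc s T) := by
    refine continuousOn_const.div (continuousOn_id.neg.mul (continuousOn_id.neg.log fun τ hτ => ?_))
      fun τ hτ => ?_
    · have h1 := hpos τ hτ
      exact (lt_trans zero_lt_one h1).ne'
    · have h1 := hpos τ hτ
      exact mul_ne_zero (lt_trans zero_lt_one h1).ne' (Real.log_pos h1).ne'
  rw [hcongr, intervalIntegral.integral_add hcont1.intervalIntegrable hcont2.intervalIntegrable,
    integral_one_div_neg_eq_log hsT hT0, integral_div_neg_mul_log_eq hsT hT]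

/-- **LOG-SCALE EXCHANGE RATE AT THE TYPE-I THRESHOLD.**  Let `v` be a class-P flow with, for all `τ < T < −1` and all
`x`: vorticity ONE `p`-TH POWER OF A LOGARITHM BELOW the Type-I rate, `‖ω(τ,x)‖ ≤ M/((−τ)(log(−τ))^p)` (any `M`),
and stretching form at most `q/log(−τ)` ABOVE the unit threshold, `⟪∇v(τ,x)ξ,ξ⟫ ≤ ((1 + q/log(−τ))/(−τ))‖ξ‖²`.  If
`q < p` then `v` is one constant vector: the ledger of `[s,T]` is
`M/((−s) Lᵖ) · ((−s)/(−T)) · (L/L_T)^q ∝ L^{q−p} → 0` (`L = log(−s)`).  `p = 0, q = −c`: the Osgood log cell of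
`TypeILiouvilleStrainLedgerOsgoodFloor`; `q = 0 < p`: vorticity `O(1/((−t) logᵖ(−t)))` with ANY constant under unit
stretching ⟹ constant. [cite: MajdaBertozziCUP2002, eq. (3.80)] -/
theorem const_of_logDials
    {v : ℝ → EuclideanSpace ℝ (Fin 3) → EuclideanSpace ℝ (Fin 3)}
    (hc : ContinuousOn (uncurry v) (Iio 0 ×ˢ univ))
    (hK : ∃ K : ℝ, ∀ t < 0, ∀ x, ‖v t x‖ ≤ K)
    (hd : ∀ t < 0, IsWeaklyDivFree (v t))
    (hm : ∀ s t : ℝ, s < t → t < 0 → ∀ x,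
      v t x = heatExtension (v s) (t - s) x - oseenDuhamel 1 s v v t x)
    {T p q M : ℝ} (hT : T < -1) (hqp : q < p)
    (hstr : ∀ τ < T, ∀ x ξ : EuclideanSpace ℝ (Fin 3),
      ⟪fderiv ℝ (v τ) x ξ, ξ⟫ ≤ (1 + q / Real.log (-τ)) / (-τ) * ‖ξ‖ ^ 2)
    (hω : ∀ τ < T, ∀ x : EuclideanSpace ℝ (Fin 3), ‖curl (v τ) x‖ ≤ M / ((-τ) * Real.log (-τ) ^ p)) :
    ∃ b : EuclideanSpace ℝ (Fin 3), ∀ t < 0, ∀ x, v t x = b := by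
  have hT0 : T < 0 := by linarith
  have hT1 : 1 < -T := by linarith
  have hLT : 0 < Real.log (-T) := Real.log_pos hT1
  -- continuous majorant on `ℝ`, equal to `(1 + q/log(−τ))/(−τ)` for `τ ≤ T`
  set Λ : ℝ → ℝ := fun τ => (1 + q / Real.log (max (-τ) (-T))) / max (-τ) (-T) with hΛ
  have hmax1 : ∀ τ : ℝ, 1 < max (-τ) (-T) := fun τ => lt_of_lt_of_le hT1 (le_max_right _ _)
  have hlogpos : ∀ τ : ℝ, 0 < Real.log (max (-τ) (-T)) := fun τ => Real.log_pos (hmax1 τ)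
  have hΛc : Continuous Λ := by
    have hmc : Continuous fun τ : ℝ => max (-τ) (-T) := continuous_neg.max continuous_const
    refine (continuous_const.add (continuous_const.div ?_ fun τ => (hlogpos τ).ne')).div hmc
      fun τ => (lt_trans zero_lt_one (hmax1 τ)).ne'
    exact hmc.log fun τ => (lt_trans zero_lt_one (hmax1 τ)).ne'
  have hΛeq : ∀ τ, τ ≤ T → Λ τ = (1 + q / Real.log (-τ)) / (-τ) := fun τ hτ => by
    simp only [hΛ, max_eq_left (neg_le_neg hτ)]
  refine const_of_pastLedger_tendsto_zero hc hK hd hm hT0 hΛc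
    (Ω := fun τ => M / ((-τ) * Real.log (-τ) ^ p))
    (fun τ hτ x ξ => by rw [hΛeq τ hτ.le]; exact hstr τ hτ x ξ) hω ?_
  -- closed form of the ledger for `s < T`
  have hclosed : ∀ s < T, M / ((-s) * Real.log (-s) ^ p) * Real.exp (∫ τ in s..T, Λ τ) =
      M / ((-T) * Real.log (-T) ^ q) * Real.log (-s) ^ (q - p) := by
    intro s hs
    have hs1 : 1 < -s := by linarith
    have hs0 : 0 < -s := by linarith
    have hL : 0 < Real.log (-s) := Real.log_pos hs1
    have hcongr : ∫ τ in s..T, Λ τ = ∫ τ in s..T, (1 + q / Real.log (-τ)) / (-τ) := by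
      refine intervalIntegral.integral_congr fun τ hτ => ?_
      rw [uIcc_of_le hs.le] at hτ
      exact hΛeq τ hτ.2
    rw [hcongr, integral_one_add_div_log_div_neg_eq hs hT, Real.exp_add, Real.exp_sub, Real.exp_log hs0,
      Real.exp_log (by linarith : (0 : ℝ) < -T), exp_mul_log_sub_log hL hLT, Real.rpow_sub hL]
    have hLp : 0 < Real.log (-s) ^ p := Real.rpow_pos_of_pos hL p
    have hLq : 0 < Real.log (-s) ^ q := Real.rpow_pos_of_pos hL q
    have hLTq : 0 < Real.log (-T) ^ q := Real.rpow_pos_of_pos hLT q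
    have hs2 : s ≠ 0 := by linarith
    have hT2 : T ≠ 0 := by linarith
    field_simp
  have hlim : Tendsto (fun s : ℝ => M / ((-T) * Real.log (-T) ^ q) * Real.log (-s) ^ (q - p)) atBot (𝓝 0) := by
    have h1 : Tendsto (fun s : ℝ => Real.log (-s) ^ (q - p)) atBot (𝓝 0) := by
      have h := (tendsto_rpow_neg_atTop (y := p - q) (by linarith)).comp
        (Real.tendsto_log_atTop.comp tendsto_neg_atBot_atTop)
      refine h.congr' (Eventually.of_forall fun s => ?_)
      simp only [Function.comp, neg_sub]
    have h := h1.const_mul (M / ((-T) * Real.log (-T) ^ q))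
    rw [mul_zero] at h
    exact h
  refine hlim.congr' ?_
  filter_upwards [eventually_lt_atBot T] with s hs
  exact (hclosed s hs).symm

/-- **LOG-SCALE EXCHANGE RATE, ALIGNED.**  The same with the stretching read only along the vorticity:
`‖ω(τ,x)‖ ≤ M/((−τ)(log(−τ))^p)` and `⟪∇v(τ,x) ω, ω⟫ ≤ ((1 + q/log(−τ))/(−τ))‖ω‖²` for `τ < T < −1`, `q < p` ⟹ one
constant vector. [cite: MajdaBertozziCUP2002, eq. (3.80)] [cite: Constantin1994, §2] -/
theorem const_of_logDials_aligned
    {v : ℝ → EuclideanSpace ℝ (Fin 3) → EuclideanSpace ℝ (Fin 3)}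
    (hc : ContinuousOn (uncurry v) (Iio 0 ×ˢ univ))
    (hK : ∃ K : ℝ, ∀ t < 0, ∀ x, ‖v t x‖ ≤ K)
    (hd : ∀ t < 0, IsWeaklyDivFree (v t))
    (hm : ∀ s t : ℝ, s < t → t < 0 → ∀ x,
      v t x = heatExtension (v s) (t - s) x - oseenDuhamel 1 s v v t x)
    {T p q M : ℝ} (hT : T < -1) (hqp : q < p)
    (hstr : ∀ τ < T, ∀ x : EuclideanSpace ℝ (Fin 3),
      ⟪fderiv ℝ (v τ) x (curl (v τ) x), curl (v τ) x⟫ ≤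
        (1 + q / Real.log (-τ)) / (-τ) * ‖curl (v τ) x‖ ^ 2)
    (hω : ∀ τ < T, ∀ x : EuclideanSpace ℝ (Fin 3), ‖curl (v τ) x‖ ≤ M / ((-τ) * Real.log (-τ) ^ p)) :
    ∃ b : EuclideanSpace ℝ (Fin 3), ∀ t < 0, ∀ x, v t x = b := by
  have hT0 : T < 0 := by linarith
  have hT1 : 1 < -T := by linarith
  have hLT : 0 < Real.log (-T) := Real.log_pos hT1
  set Λ : ℝ → ℝ := fun τ => (1 + q / Real.log (max (-τ) (-T))) / max (-τ) (-T) with hΛ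
  have hmax1 : ∀ τ : ℝ, 1 < max (-τ) (-T) := fun τ => lt_of_lt_of_le hT1 (le_max_right _ _)
  have hlogpos : ∀ τ : ℝ, 0 < Real.log (max (-τ) (-T)) := fun τ => Real.log_pos (hmax1 τ)
  have hΛc : Continuous Λ := by
    have hmc : Continuous fun τ : ℝ => max (-τ) (-T) := continuous_neg.max continuous_const
    refine (continuous_const.add (continuous_const.div ?_ fun τ => (hlogpos τ).ne')).div hmc
      fun τ => (lt_trans zero_lt_one (hmax1 τ)).ne'
    exact hmc.log fun τ => (lt_trans zero_lt_one (hmax1 τ)).ne'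
  have hΛeq : ∀ τ, τ ≤ T → Λ τ = (1 + q / Real.log (-τ)) / (-τ) := fun τ hτ => by
    simp only [hΛ, max_eq_left (neg_le_neg hτ)]
  refine const_of_pastAlignedLedger_tendsto_zero hc hK hd hm hT0 hΛc
    (Ω := fun τ => M / ((-τ) * Real.log (-τ) ^ p))
    (fun τ hτ x => by rw [hΛeq τ hτ.le]; exact hstr τ hτ x) hω ?_
  have hclosed : ∀ s < T, M / ((-s) * Real.log (-s) ^ p) * Real.exp (∫ τ in s..T, Λ τ) =
      M / ((-T) * Real.log (-T) ^ q) * Real.log (-s) ^ (q - p) := by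
    intro s hs
    have hs1 : 1 < -s := by linarith
    have hs0 : 0 < -s := by linarith
    have hL : 0 < Real.log (-s) := Real.log_pos hs1
    have hcongr : ∫ τ in s..T, Λ τ = ∫ τ in s..T, (1 + q / Real.log (-τ)) / (-τ) := by
      refine intervalIntegral.integral_congr fun τ hτ => ?_
      rw [uIcc_of_le hs.le] at hτ
      exact hΛeq τ hτ.2
    rw [hcongr, integral_one_add_div_log_div_neg_eq hs hT, Real.exp_add, Real.exp_sub, Real.exp_log hs0,
      Real.exp_log (by linarith : (0 : ℝ) < -T), exp_mul_log_sub_log hL hLT, Real.rpow_sub hL]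
    have hLp : 0 < Real.log (-s) ^ p := Real.rpow_pos_of_pos hL p
    have hLq : 0 < Real.log (-s) ^ q := Real.rpow_pos_of_pos hL q
    have hLTq : 0 < Real.log (-T) ^ q := Real.rpow_pos_of_pos hLT q
    have hs2 : s ≠ 0 := by linarith
    have hT2 : T ≠ 0 := by linarith
    field_simp
  have hlim : Tendsto (fun s : ℝ => M / ((-T) * Real.log (-T) ^ q) * Real.log (-s) ^ (q - p)) atBot (𝓝 0) := by
    have h1 : Tendsto (fun s : ℝ => Real.log (-s) ^ (q - p)) atBot (𝓝 0) := by
      have h := (tendsto_rpow_neg_atTop (y := p - q) (by linarith)).comp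
        (Real.tendsto_log_atTop.comp tendsto_neg_atBot_atTop)
      refine h.congr' (Eventually.of_forall fun s => ?_)
      simp only [Function.comp, neg_sub]
    have h := h1.const_mul (M / ((-T) * Real.log (-T) ^ q))
    rw [mul_zero] at h
    exact h
  refine hlim.congr' ?_
  filter_upwards [eventually_lt_atBot T] with s hs
  exact (hclosed s hs).symm

end Summit.NavierStokesRegularity.NavierStokesRegularity.Theorems.TypeILiouvilleStrainLedger

end
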